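import Summits.NavierStokesRegularity.NavierStokesRegularity.Theorems.CircuitPump.Negative.LoadBearing
import Literature.Analysis.ODE.ConfinedAutonomous
import Literature.Analysis.ODE.LipschitzFlow

/-!
# The flow of the `L`-truncated lattice system
# (crux `PerpetualPump.CircuitPump`, stmt-NavierStokesRegularity-1834;
# line `singular-clock-gspt`, stub C1 `stub_truncatedFlow`)

For Tao's viscous circuit `rhsF` (`Theorems/CircuitPump/Negative/LoadBearing.lean`) truncated to
the modes `|n| ≤ L` (outside modes frozen at `0`), and a set `S` of data vanishing off `|n| ≤ L`
such that every truncated solution issued from `S` obeys the a priori weighted bound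
`lam^{3n/5} |Z_{i,n}(t)| ≤ C` on every `[0, T'] ⊆ [0, Tmax]`, there is a flow map
`Φ : datum → time → state` solving the truncated system on `[0, Tmax]` from every `x ∈ S`, jointly
continuous in `(x, t) ∈ S × [0, Tmax]` coordinatewise (`stub_truncatedFlow`).

Proof. Transport to the finite-dimensional space `E = Fin m → Icc (-L) L → ℝ`, where the
truncated system is an autonomous polynomial (hence `C¹`) ODE `y' = V y`
(`truncatedFlow_contDiff`). The generic lemma `truncatedFlow_flow`: multiply `V` by a smooth
bump equal to `1` on the a priori ball to get a globally Lipschitz `C¹` field `g`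
(`ContDiff.lipschitzWith_of_hasCompactSupport`), whose global flow
(`Literature.Analysis.ODE.lipschitzFlow`) is jointly `C¹`; a `V`-solution on `[0, Tmax]` exists
by the tree's continuation principle `Literature.Analysis.ODE.exists_solution_of_confined` and
stays in the ball (a priori bound), so by uniqueness (`ODE_solution_unique`) it is the flow line
of `g`, which therefore solves `y' = V y` on `[0, Tmax]`. [folklore]
-/

noncomputable section

-- the summit namespace `…NavierStokesRegularity.NavierStokesRegularity…` is the tree convention
set_option linter.dupNamespace false

namespace Summit.NavierStokesRegularity.NavierStokesRegularity.Theorems.PerpetualPumpCircuitPump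

open Set Metric Filter Topology
open scoped NNReal
open Summit.NavierStokesRegularity.NavierStokesRegularity.Theorems.CircuitPumpNegative
open Literature.Analysis.ODE

/-- **Flow of a `C¹` field under an a priori bound, with continuous dependence.** If every
solution of `y' = V y` (`V` of class `C¹` on a finite-dimensional space) issued from a point of
`A` on any `[0, s] ⊆ [0, T]`, `s > 0`, stays in the ball `‖y‖ ≤ R`, then there is a jointly
continuous `Ψ : E → ℝ → E` with `Ψ a 0 = a` and `Ψ a` a solution on `[0, T]` for every `a ∈ A`
(the global flow of `χ • V`, `χ` a smooth bump equal to `1` on the ball; continuation principle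
and uniqueness). [folklore] -/
theorem truncatedFlow_flow {E : Type*} [NormedAddCommGroup E] [NormedSpace ℝ E]
    [FiniteDimensional ℝ E] {V : E → E} (hV : ContDiff ℝ 1 V) {A : Set E} {T R : ℝ} (hT : 0 < T)
    (hAp : ∀ a ∈ A, ∀ s : ℝ, 0 < s → s ≤ T → ∀ β : ℝ → E, β 0 = a →
      (∀ t ∈ Icc 0 s, HasDerivWithinAt β (V (β t)) (Icc 0 s) t) → ∀ t ∈ Icc 0 s, ‖β t‖ ≤ R) :
    ∃ Ψ : E → ℝ → E, Continuous (fun p : E × ℝ => Ψ p.1 p.2) ∧ ∀ a ∈ A, Ψ a 0 = a ∧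
      ∀ t ∈ Icc 0 T, HasDerivWithinAt (Ψ a) (V (Ψ a t)) (Icc 0 T) t := by
  -- a smooth cutoff equal to `1` on the a priori ball
  let χ : ContDiffBump (0 : E) := ⟨|R| + 1, |R| + 2, by positivity, by linarith⟩
  set g : E → E := fun y => χ y • V y with hg
  have hg1 : ContDiff ℝ 1 g := (χ.contDiff (n := 1)).smul hV
  have hgc : HasCompactSupport g := χ.hasCompactSupport.smul_right
  obtain ⟨K, hK⟩ := hg1.lipschitzWith_of_hasCompactSupport hgc one_ne_zero
  have hgV : ∀ y : E, ‖y‖ ≤ R → g y = V y := fun y hy => by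
    have hy' : y ∈ closedBall (0 : E) χ.rIn := by
      rw [mem_closedBall, dist_zero_right]
      exact hy.trans ((le_abs_self R).trans (by simp [χ]))
    simp only [hg, χ.one_of_mem_closedBall hy', one_smul]
  refine ⟨lipschitzFlow hK, (contDiff_lipschitzFlow hg1 le_rfl hK).continuous, fun a ha => ?_⟩
  refine ⟨lipschitzFlow_zero hK a, ?_⟩
  -- a `V`-solution on `[0, T]` from `a`, confined to the a priori ball
  obtain ⟨β, hβ0, hβ⟩ := exists_solution_of_confined (F := V) (O := univ)
    (K := closedBall (0 : E) (max R ‖a‖)) isOpen_univ hV.contDiffOn (isCompact_closedBall _ _)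
    (subset_univ _) (x₀ := a) hT.le (fun s hs X hX0 hX t ht => by
      rw [mem_closedBall, dist_zero_right]
      rcases eq_or_lt_of_le hs.1 with h0 | hpos
      · have ht0 : t = 0 := le_antisymm (h0 ▸ ht.2) ht.1
        rw [ht0, hX0]
        exact le_max_right _ _
      · exact (hAp a ha s hpos hs.2 X hX0 hX t ht).trans (le_max_left _ _))
  have hβR : ∀ t ∈ Icc 0 T, ‖β t‖ ≤ R := hAp a ha T hT le_rfl β hβ0 hβ
  -- by uniqueness it is the flow line of `g`
  have heq : EqOn (lipschitzFlow hK a) β (Icc 0 T) := by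
    refine ODE_solution_unique (v := fun _ => g) (fun _ => hK)
      (continuous_lipschitzFlow hK a).continuousOn
      (fun t _ => (hasDerivAt_lipschitzFlow hK a t).hasDerivWithinAt)
      (fun t ht => (hβ t ht).continuousWithinAt) (fun t ht => ?_) (by rw [lipschitzFlow_zero, hβ0])
    have h1 : HasDerivWithinAt β (V (β t)) (Ici t) t :=
      (hβ t ⟨ht.1, ht.2.le⟩).mono_of_mem_nhdsWithin
        (mem_of_superset (Icc_mem_nhdsGE ht.2) (Icc_subset_Icc_left ht.1))
    rwa [← hgV (β t) (hβR t ⟨ht.1, ht.2.le⟩)] at h1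
  intro t ht
  have h1 := (hasDerivAt_lipschitzFlow hK a t).hasDerivWithinAt (s := Icc 0 T)
  rwa [hgV _ (by rw [heq ht]; exact hβR t ht)] at h1

/-- From the weighted bound `lam^{3k/5} |z| ≤ C` on the window `-L ≤ k` to the plain bound
`|z| ≤ |C| lam^{3L/5}` (`lam > 1`). -/
theorem truncatedFlow_abs_le {lam C z : ℝ} (hlam : 1 < lam) {L : ℕ} {k : ℤ} (hk : -(L : ℤ) ≤ k)
    (h : lam ^ ((3 / 5 : ℝ) * k) * |z| ≤ C) : |z| ≤ |C| * lam ^ ((3 / 5 : ℝ) * L) := by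
  have hlam0 : 0 < lam := by linarith
  have hpos : 0 < lam ^ ((3 / 5 : ℝ) * k) := Real.rpow_pos_of_pos hlam0 _
  have h1 : |z| ≤ |C| * lam ^ (-((3 / 5 : ℝ) * k)) := by
    rw [Real.rpow_neg hlam0.le, ← div_eq_mul_inv, le_div_iff₀ hpos]
    calc |z| * lam ^ ((3 / 5 : ℝ) * k) = lam ^ ((3 / 5 : ℝ) * k) * |z| := mul_comm _ _
      _ ≤ C := h
      _ ≤ |C| := le_abs_self C
  have h2 : lam ^ (-((3 / 5 : ℝ) * k)) ≤ lam ^ ((3 / 5 : ℝ) * L) := by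
    refine Real.rpow_le_rpow_of_exponent_le hlam.le ?_
    have : (-(L : ℝ)) ≤ k := by exact_mod_cast hk
    linarith
  exact h1.trans (mul_le_mul_of_nonneg_left h2 (abs_nonneg C))

/-- The truncated vector field on `E = Fin m → Icc (-L) L → ℝ` (the circuit `rhsF` with the
modes `|n| > L` read as `0`) is of class `C¹`: it is polynomial in the coordinates. -/
theorem truncatedFlow_contDiff (lam : ℝ) {m : ℕ}
    (coeff : Fin m → Fin m → Fin m → Option (Fin 3) → ℝ) (L : ℕ) :
    ContDiff ℝ 1 (fun (y : Fin m → ↥(Set.Icc (-(L : ℤ)) (L : ℤ)) → ℝ) (i : Fin m)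
        (k : ↥(Set.Icc (-(L : ℤ)) (L : ℤ))) =>
      rhsF lam coeff (fun i' n' (_ : ℝ) => if h : |n'| ≤ (L : ℤ) then y i' ⟨n', abs_le.1 h⟩ else 0)
        i k 0) := by
  have hc : ∀ (i' : Fin m) (n' : ℤ),
      ContDiff ℝ 1 (fun y : Fin m → ↥(Set.Icc (-(L : ℤ)) (L : ℤ)) → ℝ =>
        if h : |n'| ≤ (L : ℤ) then y i' ⟨n', abs_le.1 h⟩ else 0) := by
    intro i' n'
    by_cases h : |n'| ≤ (L : ℤ)
    · simp only [dif_pos h]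
      exact contDiff_apply_apply ℝ ℝ i' (⟨n', abs_le.1 h⟩ : ↥(Set.Icc (-(L : ℤ)) (L : ℤ)))
    · simp only [dif_neg h]
      exact contDiff_const
  refine contDiff_pi.2 fun i => contDiff_pi.2 fun k => ?_
  simp only [rhsF]
  refine (contDiff_const.mul (hc i k)).add ?_
  refine ContDiff.sum fun i₁ _ => ContDiff.sum fun i₂ _ => ContDiff.sum fun μ _ => ?_
  exact (contDiff_const.mul (hc _ _)).mul (hc _ _)

/-- **Stub C1 (`TruncatedFlow`).** Global existence on `[0, Tmax]` and joint continuity in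
(datum, time) of the flow of the `L`-truncated lattice system from an a priori weighted bound:
transport to `E = Fin m → Icc (-L) L → ℝ` and `truncatedFlow_flow`. [folklore] -/
theorem stub_truncatedFlow :
    ∀ (lam : ℝ), 1 < lam → ∀ (m : ℕ) (coeff : Fin m → Fin m → Fin m → Option (Fin 3) → ℝ)
    (L : ℕ) (Tmax C : ℝ) (S : Set (Fin m → ℤ → ℝ)), 0 < Tmax →
    (∀ x ∈ S, ∀ (i : Fin m) (n : ℤ), (L : ℤ) < |n| → x i n = 0) →
    (∀ x ∈ S, ∀ (T' : ℝ) (Z : Fin m → ℤ → ℝ → ℝ), 0 < T' → T' ≤ Tmax →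
        ((∀ (i : Fin m) (n : ℤ), Z i n 0 = x i n) ∧
          (∀ (i : Fin m) (n : ℤ), (L : ℤ) < |n| → ∀ t ∈ Set.Icc (0 : ℝ) T', Z i n t = 0) ∧
          (∀ (i : Fin m) (n : ℤ), |n| ≤ (L : ℤ) → ∀ t ∈ Set.Icc (0 : ℝ) T',
            HasDerivWithinAt (Z i n)
              (Summit.NavierStokesRegularity.NavierStokesRegularity.Theorems.CircuitPumpNegative.rhsF
                lam coeff Z i n t) (Set.Icc (0 : ℝ) T') t)) →
        ∀ (i : Fin m) (n : ℤ), ∀ t ∈ Set.Icc (0 : ℝ) T', lam ^ ((3 / 5 : ℝ) * n) * |Z i n t| ≤ C) →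
    ∃ Φ : (Fin m → ℤ → ℝ) → ℝ → (Fin m → ℤ → ℝ),
      (∀ x ∈ S,
        (∀ (i : Fin m) (n : ℤ), Φ x 0 i n = x i n) ∧
          (∀ (i : Fin m) (n : ℤ), (L : ℤ) < |n| → ∀ t ∈ Set.Icc (0 : ℝ) Tmax, Φ x t i n = 0) ∧
          (∀ (i : Fin m) (n : ℤ), |n| ≤ (L : ℤ) → ∀ t ∈ Set.Icc (0 : ℝ) Tmax,
            HasDerivWithinAt (fun s => Φ x s i n)
              (Summit.NavierStokesRegularity.NavierStokesRegularity.Theorems.CircuitPumpNegative.rhsF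
                lam coeff (fun i' n' s => Φ x s i' n') i n t) (Set.Icc (0 : ℝ) Tmax) t)) ∧
      (∀ (i : Fin m) (n : ℤ),
        ContinuousOn (fun p : (Fin m → ℤ → ℝ) × ℝ => Φ p.1 p.2 i n) (S ×ˢ Set.Icc (0 : ℝ) Tmax)) := by
  intro lam hlam m coeff L Tmax C S hTmax hS hAp
  have hlam0 : 0 < lam := by linarith
  have hR0 : 0 ≤ |C| * lam ^ ((3 / 5 : ℝ) * L) := by positivity
  have hflow := truncatedFlow_flow (truncatedFlow_contDiff lam coeff L)
    (A := (fun (x : Fin m → ℤ → ℝ) (i : Fin m) (k : ↥(Set.Icc (-(L : ℤ)) (L : ℤ))) => x i k) '' S)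
    (R := |C| * lam ^ ((3 / 5 : ℝ) * L)) hTmax
  refine (hflow ?_).elim fun Ψ hΨ' => ?_
  · -- the a priori bound, transported to `E`
    rintro _ ⟨x, hx, rfl⟩ s hs hsT β hβ0 hβ t ht
    set Z : Fin m → ℤ → ℝ → ℝ :=
      fun i n τ => if h : |n| ≤ (L : ℤ) then β τ i ⟨n, abs_le.1 h⟩ else 0 with hZ
    have h1 : ∀ (i : Fin m) (n : ℤ), Z i n 0 = x i n := by
      intro i n
      by_cases hn : |n| ≤ (L : ℤ)
      · simp only [hZ, dif_pos hn, hβ0]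
      · simp only [hZ, dif_neg hn]
        exact (hS x hx i n (not_le.1 hn)).symm
    have h2 : ∀ (i : Fin m) (n : ℤ), (L : ℤ) < |n| → ∀ τ ∈ Set.Icc (0 : ℝ) s, Z i n τ = 0 :=
      fun i n hn τ _ => by simp only [hZ, dif_neg (not_le.2 hn)]
    have h3 : ∀ (i : Fin m) (n : ℤ), |n| ≤ (L : ℤ) → ∀ τ ∈ Set.Icc (0 : ℝ) s,
        HasDerivWithinAt (Z i n) (rhsF lam coeff Z i n τ) (Set.Icc (0 : ℝ) s) τ := by
      intro i n hn τ hτ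
      have hd := hasDerivWithinAt_pi.1 (hasDerivWithinAt_pi.1 (hβ τ hτ) i) ⟨n, abs_le.1 hn⟩
      have hZn : Z i n = fun τ' => β τ' i ⟨n, abs_le.1 hn⟩ := by
        funext τ'
        simp only [hZ, dif_pos hn]
      rw [hZn]
      exact hd
    have hw := hAp x hx s Z hs hsT ⟨h1, h2, h3⟩
    rw [pi_norm_le_iff_of_nonneg hR0]
    intro i
    rw [pi_norm_le_iff_of_nonneg hR0]
    intro k
    have hk := hw i k t ht
    have hZk : Z i k t = β t i k := by simp only [hZ, dif_pos (abs_le.2 (Set.mem_Icc.1 k.2))]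
    rw [hZk] at hk
    rw [Real.norm_eq_abs]
    exact truncatedFlow_abs_le hlam k.2.1 hk
  · -- the flow, transported back to the lattice
    obtain ⟨hΨc, hΨ⟩ := hΨ'
    refine ⟨fun x t i n => if h : |n| ≤ (L : ℤ) then
        Ψ (fun (i' : Fin m) (k : ↥(Set.Icc (-(L : ℤ)) (L : ℤ))) => x i' k) t i ⟨n, abs_le.1 h⟩ else 0,
      fun x hx => ?_, fun i n => ?_⟩
    · obtain ⟨h0, hd⟩ := hΨ _ ⟨x, hx, rfl⟩
      refine ⟨fun i n => ?_, fun i n hn t _ => by simp only [dif_neg (not_le.2 hn)],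
        fun i n hn t ht => ?_⟩
      · by_cases hn : |n| ≤ (L : ℤ)
        · simp only [dif_pos hn, h0]
        · simp only [dif_neg hn]
          exact (hS x hx i n (not_le.1 hn)).symm
      · have h1 := hasDerivWithinAt_pi.1 (hasDerivWithinAt_pi.1 (hd t ht) i) ⟨n, abs_le.1 hn⟩
        simp only [dif_pos hn]
        exact h1
    · by_cases hn : |n| ≤ (L : ℤ)
      · simp only [dif_pos hn]
        have hr : Continuous (fun p : (Fin m → ℤ → ℝ) × ℝ =>
            ((fun (i' : Fin m) (k : ↥(Set.Icc (-(L : ℤ)) (L : ℤ))) => p.1 i' k), p.2)) := by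
          refine (continuous_pi fun i' => continuous_pi fun k => ?_).prodMk continuous_snd
          exact (continuous_apply (k : ℤ)).comp ((continuous_apply i').comp continuous_fst)
        exact ((continuous_apply _).comp ((continuous_apply i).comp (hΨc.comp hr))).continuousOn
      · simpa only [dif_neg hn] using continuousOn_const

end Summit.NavierStokesRegularity.NavierStokesRegularity.Theorems.PerpetualPumpCircuitPump
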